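import Mathlib
import Literature.NumberTheory.LFunctions.MauduitRivatMoebiusDigital
import Literature.NumberTheory.Sieve.VinogradovExpSumTools
import Summits.QuantumAdvantage.QuantumAdvantage.Theorems.MobiusLadderLiouvilleOrthogonalTC0StubGelfondSmallMoebius
import Summits.QuantumAdvantage.QuantumAdvantage.Theorems.MobiusLadderLiouvilleOrthogonalTC0StubSymmetricRungMoebius
import Literature.Computability.Complexity.Circuit
import Literature.Probability.RandomGraphs.LowDegree
import HarnessLib

/-!
# Kalai's `TC⁰` conjecture on the SYMMETRIC subclass, for `μ`, modulo the printed Mauduit–Rivat 2015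
Theorem 2 (line `Sketch`, v8.2: the `μ`-twin of the symmetric-digital rung)

Line `Sketch` (lead `prover-line-stmt-QuantumAdvantage-1393-c5-0`). By v8.1 the crux
`LiouvilleOrthogonalTC0` IS Kalai's `TC⁰` conjecture for `μ` (`liouvilleOrthogonalTC0_iff_kalai`). The
symmetric-digital rung of v8 was proved for `λ` modulo the unprinted hypothesis `GelfondLiouvilleDecay`.
For `μ` the corresponding large-frequency Gelfond bound IS a printed theorem: Mauduit–Rivat, J. Eur.
Math. Soc. 17 (2015), Theorem 2 (named fact `Literature.NumberTheory.LFunctions.mauduitRivat2015_thm2_base2`,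
quantitative base-2 form), applied to `f = e(α s₂)` whose carry and Fourier properties are PROVED in the
tree (`SumOfDigitsCarry.lean`, `SumOfDigitsFourier.lean`). This file proves:

* `MoebiusSymm.gelfondLarge_moebius_of_bound` / `gelfondLarge_moebius_of_thm2` — the large frequencies
  `n^{a−1/2} ≤ |α| ≤ 1/2`: `|Σ_{N<2ⁿ} μ(N) e(α s₂(N))| ≤ 2ⁿ/n^B` eventually, for every `a > 0`, `B`
  (from the `μ`-Gelfond bound: `x = 2ⁿ − 1`, `‖α‖ = |α|`, `L ≥ n/80`, so the saving is
  `≤ 2^{c₃/20} 2^{−(c₂/1600) n^{2a}}`, which beats `K (log x)⁴ n^B`);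
* **`moebius_orthogonal_symmetric_of_thm2`** — `mauduitRivat2015_thm2_base2 →` for every `ε > 0`,
  eventually in `n`, `|Σ_{N<2ⁿ} μ(N) sgn G(s₂(N))| ≤ ε 2ⁿ` for ALL `G : ℕ → Bool` (with the
  UNCONDITIONAL small-frequency bound `stub_gelfondSmall_moebius` — Bourgain's theorem for `μ`, proved in
  the tree — and the `μ`-rung `stub_symmetricRung_moebius`);
* `moebius_orthogonal_symmetricCircuit_of_thm2` — the same for every circuit (any basis, depth, size)
  computing a symmetric function of its inputs: Kalai's `TC⁰` conjecture holds on the symmetric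
  subclass, conditionally on the printed Theorem 2 only.
-/

set_option linter.dupNamespace false -- D-0017: single-problem summit ⇒ `QuantumAdvantage.QuantumAdvantage` by design

noncomputable section

namespace Summit.QuantumAdvantage.QuantumAdvantage.Theorems.LiouvilleOrthogonalTC0

open Filter Finset
open Literature.Computability.Complexity
open Literature.Probability.RandomGraphs.LowDegree (sgn)
open Literature.NumberTheory.Sieve.Vinogradov (distInt distInt_nonneg distInt_le_abs_sub_int)
open Literature.NumberTheory.LFunctions.SumOfDigits (digitSum_eq_card_testBit)

namespace MoebiusSymm

/-- For `|α| ≤ 1/2` the distance to the nearest integer is `|α|`. -/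
theorem distInt_eq_abs {α : ℝ} (hα : |α| ≤ 1 / 2) : distInt α = |α| := by
  refine le_antisymm (by simpa using distInt_le_abs_sub_int α 0) ?_
  -- `|α - m| ≥ |α|` for every integer `m`
  unfold distInt
  set m : ℤ := round α
  rcases eq_or_ne m 0 with hm | hm
  · simp [hm]
  · have h1 : (1 : ℝ) ≤ |(m : ℝ)| := by
      rw [← Int.cast_abs]; exact_mod_cast Int.one_le_abs hm
    have h2 : |(m : ℝ)| - |α| ≤ |α - m| := by
      have := abs_sub_abs_le_abs_sub (m : ℝ) α
      rw [abs_sub_comm] at this; linarith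
    linarith

/-- The Hamming weight on `Fin n` is the `testBit` count on `range n`. -/
theorem card_univ_filter_testBit (n N : ℕ) :
    (univ.filter fun i : Fin n => Nat.testBit N i = true).card =
      ((range n).filter fun i => Nat.testBit N i = true).card := by
  rw [card_filter, card_filter]
  exact Fin.sum_univ_eq_sum_range (fun i => if Nat.testBit N i = true then 1 else 0) n

/-- Stretched-exponential beats polynomial: `A·n^r ≤ 2^{κ n^e}` eventually (`κ, e > 0`). -/
theorem eventually_mul_pow_le_two_rpow {A κ e : ℝ} (r : ℕ) (hκ : 0 < κ) (he : 0 < e) :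
    ∀ᶠ n : ℕ in atTop, A * (n : ℝ) ^ r ≤ (2 : ℝ) ^ (κ * (n : ℝ) ^ e) := by
  -- compare logarithms: `log A + r log n ≤ κ n^e log 2`
  have hlog2 : 0 < Real.log 2 := Real.log_pos one_lt_two
  have ho := (isLittleO_log_rpow_atTop he).bound (show (0 : ℝ) < κ * Real.log 2 / (2 * (r + 1)) by positivity)
  have ho' := (tendsto_natCast_atTop_atTop (R := ℝ)).eventually ho
  have hgrow : Tendsto (fun n : ℕ => κ * Real.log 2 / 2 * (n : ℝ) ^ e) atTop atTop :=
    Tendsto.const_mul_atTop (by positivity) ((tendsto_rpow_atTop he).comp tendsto_natCast_atTop_atTop)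
  filter_upwards [ho', hgrow.eventually_ge_atTop (Real.log (max A 1)), eventually_ge_atTop 1] with n hn hA hn1
  have hn0 : (0 : ℝ) < n := by exact_mod_cast hn1
  have hmax : A ≤ max A 1 := le_max_left _ _
  have hm1 : (1 : ℝ) ≤ max A 1 := le_max_right _ _
  calc A * (n : ℝ) ^ r ≤ max A 1 * (n : ℝ) ^ r := by gcongr
    _ = Real.exp (Real.log (max A 1) + r * Real.log n) := by
        rw [Real.exp_add, Real.exp_log (by linarith), ← Real.rpow_natCast,
          Real.rpow_def_of_pos hn0, mul_comm (Real.log n)]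
    _ ≤ Real.exp (Real.log 2 * (κ * (n : ℝ) ^ e)) := by
        refine Real.exp_le_exp.2 ?_
        have h1 : Real.log (n : ℝ) ≤ κ * Real.log 2 / (2 * (r + 1)) * (n : ℝ) ^ e := by
          have := hn
          rw [Real.norm_eq_abs, Real.norm_eq_abs, abs_of_nonneg (Real.log_nonneg (by exact_mod_cast hn1)),
            abs_of_nonneg (by positivity)] at this
          exact this
        have h2 : (r : ℝ) * Real.log n ≤ κ * Real.log 2 / 2 * (n : ℝ) ^ e := by
          calc (r : ℝ) * Real.log n ≤ r * (κ * Real.log 2 / (2 * (r + 1)) * (n : ℝ) ^ e) := by gcongr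
            _ = (r / (r + 1)) * (κ * Real.log 2 / 2 * (n : ℝ) ^ e) := by field_simp
            _ ≤ 1 * (κ * Real.log 2 / 2 * (n : ℝ) ^ e) := by
                refine mul_le_mul_of_nonneg_right ?_ (by positivity)
                rw [div_le_one (by positivity)]; linarith
            _ = κ * Real.log 2 / 2 * (n : ℝ) ^ e := one_mul _
        linarith
    _ = (2 : ℝ) ^ (κ * (n : ℝ) ^ e) := by rw [Real.rpow_def_of_pos two_pos]

/-- **Large frequencies of the Möbius–Gelfond sums from a Mauduit–Rivat type bound.** If for some `K`,
all `α` with `‖α‖ ≠ 0` and all `x ≥ 2`,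
`|Σ_{1≤m≤x} μ(m) e(α s₂(m))| ≤ K (log x)⁴ x 2^{−(c₂‖α‖²L − c₃)/20}`, `L = 2⌊log x/(80 log 2)⌋`,
`c₂ = π²/(36 log 2)`, `c₃ = π²/(144 log 2)` (the conclusion of
`SumOfDigits.norm_sum_moebius_exp_digitSum_le_of_thm2`), then for every `a > 0` and `B`, eventually in
`n`, `|Σ_{N<2ⁿ} μ(N) e(α s₂(N))| ≤ 2ⁿ/n^B` for all `n^{a−1/2} ≤ |α| ≤ 1/2`. -/
theorem gelfondLarge_moebius_of_bound
    (hK : ∃ K : ℝ, ∀ (α : ℝ), distInt α ≠ 0 → ∀ (x : ℕ), 2 ≤ x →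
      ‖∑ n ∈ Finset.Icc 1 x, (ArithmeticFunction.moebius n : ℂ) *
          Complex.exp (((2 * Real.pi * (α * ((Nat.digits 2 n).sum : ℕ))) : ℝ) * Complex.I)‖ ≤
        K * Real.log x ^ 4 * x *
          (2 : ℝ) ^ (-(Real.pi ^ 2 / (36 * Real.log 2) * distInt α ^ 2 *
              (2 * (⌊Real.log x / (80 * Real.log 2)⌋₊ : ℝ)) - Real.pi ^ 2 / (144 * Real.log 2)) / 20)) :
    ∀ a : ℝ, 0 < a → ∀ B : ℕ, ∀ᶠ n : ℕ in atTop, ∀ α : ℝ,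
      (n : ℝ) ^ (a - 1 / 2) ≤ |α| → |α| ≤ 1 / 2 →
        ‖∑ N ∈ Finset.range (2 ^ n), ((ArithmeticFunction.moebius N : ℤ) : ℂ) *
            Complex.exp (((2 * Real.pi * α *
              ((Finset.univ.filter fun i : Fin n => Nat.testBit N i = true).card : ℝ) : ℝ) : ℂ) * Complex.I)‖
          ≤ (2 : ℝ) ^ n / (n : ℝ) ^ B := by
  obtain ⟨K, hK⟩ := hK
  intro a ha B
  have hlog2 : 0 < Real.log 2 := Real.log_pos one_lt_two
  set c₂ : ℝ := Real.pi ^ 2 / (36 * Real.log 2) with hc₂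
  set c₃ : ℝ := Real.pi ^ 2 / (144 * Real.log 2) with hc₃
  have hc₂0 : 0 < c₂ := by positivity
  -- the asymptotic inequality, uniform in `α`
  have hev := eventually_mul_pow_le_two_rpow (A := max K 0 * Real.log 2 ^ 4 * (2 : ℝ) ^ (c₃ / 20))
    (4 + B) (κ := c₂ / 1600) (e := 2 * a) (by positivity) (by positivity)
  filter_upwards [hev, eventually_ge_atTop 162] with n hn hn162 α hαlo hαhi
  have hn1 : (1 : ℝ) ≤ n := by exact_mod_cast (show 1 ≤ n by omega)
  have hn0 : (0 : ℝ) < n := by linarith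
  -- the frequency
  have hd : distInt α = |α| := distInt_eq_abs hαhi
  have hαpos : 0 < |α| := lt_of_lt_of_le (Real.rpow_pos_of_pos hn0 _) hαlo
  have hd0 : distInt α ≠ 0 := by rw [hd]; exact hαpos.ne'
  -- `x = 2ⁿ - 1`
  set x : ℕ := 2 ^ n - 1 with hx
  have h2n : 2 ^ 8 ≤ 2 ^ n := Nat.pow_le_pow_right (by norm_num) (by omega)
  have hx2 : 2 ≤ x := by rw [hx]; omega
  have hxpos : (0 : ℝ) < x := by exact_mod_cast (show 0 < x by omega)
  have hx_le : (x : ℝ) ≤ (2 : ℝ) ^ n := by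
    rw [hx]; exact_mod_cast Nat.sub_le _ _
  have hx_ge : (2 : ℝ) ^ (n - 1) ≤ x := by
    rw [hx]
    have : 2 ^ (n - 1) ≤ 2 ^ n - 1 := by
      have h1 : 2 ^ n = 2 * 2 ^ (n - 1) := by
        rw [← pow_succ']; congr 1; omega
      omega
    exact_mod_cast this
  -- rewrite the sum over `range (2ⁿ)` as the digital sum over `Icc 1 x`
  have hsum : ∑ N ∈ Finset.range (2 ^ n), ((ArithmeticFunction.moebius N : ℤ) : ℂ) *
      Complex.exp (((2 * Real.pi * α *
        ((Finset.univ.filter fun i : Fin n => Nat.testBit N i = true).card : ℝ) : ℝ) : ℂ) * Complex.I) =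
      ∑ N ∈ Finset.Icc 1 x, (ArithmeticFunction.moebius N : ℂ) *
        Complex.exp (((2 * Real.pi * (α * ((Nat.digits 2 N).sum : ℕ))) : ℝ) * Complex.I) := by
    have hsplit : Finset.range (2 ^ n) = insert 0 (Finset.Icc 1 x) := by
      ext N; simp only [mem_range, mem_insert, mem_Icc, hx]; omega
    rw [hsplit, sum_insert (by simp), ArithmeticFunction.map_zero, Int.cast_zero, zero_mul, zero_add]
    refine sum_congr rfl fun N hN => ?_
    have hNlt : N < 2 ^ n := by rw [mem_Icc, hx] at hN; omega
    rw [card_univ_filter_testBit, ← digitSum_eq_card_testBit n N hNlt]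
    have e : (2 * Real.pi * α * (((Nat.digits 2 N).sum : ℕ) : ℝ) : ℝ) =
        2 * Real.pi * (α * (((Nat.digits 2 N).sum : ℕ) : ℝ)) := by ring
    rw [e]
  rw [hsum]
  refine (hK α hd0 x hx2).trans ?_
  -- the exponent: `c₂ d² L - c₃ ≥ (c₂/80) n^{2a} - c₃` with `L ≥ n/80`
  have hL : (n : ℝ) / 80 ≤ 2 * (⌊Real.log x / (80 * Real.log 2)⌋₊ : ℝ) := by
    have h1 : ((n : ℝ) - 1) * Real.log 2 ≤ Real.log x := by
      have := Real.log_le_log (by positivity) hx_ge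
      rwa [Real.log_pow, Nat.cast_sub (by omega), Nat.cast_one] at this
    have h2 : ((n : ℝ) - 1) / 80 ≤ Real.log x / (80 * Real.log 2) := by
      rw [div_le_div_iff₀ (by norm_num) (by positivity)]; nlinarith
    have h3 : ((n : ℝ) - 1) / 80 - 1 ≤ (⌊Real.log x / (80 * Real.log 2)⌋₊ : ℝ) :=
      le_trans (by linarith) (Nat.sub_one_lt_floor _).le
    have hn' : (162 : ℝ) ≤ n := by exact_mod_cast hn162
    linarith
  have hd2 : (n : ℝ) ^ (2 * a - 1) ≤ distInt α ^ 2 := by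
    rw [hd]
    have := pow_le_pow_left₀ (Real.rpow_nonneg hn0.le _) hαlo 2
    rwa [← Real.rpow_natCast, ← Real.rpow_mul hn0.le, show (a - 1 / 2) * ((2 : ℕ) : ℝ) = 2 * a - 1 by
      push_cast; ring] at this
  have hexp : c₂ / 80 * (n : ℝ) ^ (2 * a) - c₃ ≤
      c₂ * distInt α ^ 2 * (2 * (⌊Real.log x / (80 * Real.log 2)⌋₊ : ℝ)) - c₃ := by
    have h1 : c₂ * ((n : ℝ) ^ (2 * a - 1)) * ((n : ℝ) / 80) ≤
        c₂ * distInt α ^ 2 * (2 * (⌊Real.log x / (80 * Real.log 2)⌋₊ : ℝ)) := by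
      refine mul_le_mul (mul_le_mul_of_nonneg_left hd2 hc₂0.le) hL (by positivity) (by positivity)
    have h2 : c₂ * ((n : ℝ) ^ (2 * a - 1)) * ((n : ℝ) / 80) = c₂ / 80 * (n : ℝ) ^ (2 * a) := by
      have : (n : ℝ) ^ (2 * a) = (n : ℝ) ^ (2 * a - 1) * n := by
        rw [← Real.rpow_add_one hn0.ne']; ring_nf
      rw [this]; ring
    linarith
  -- so the saving is at most `2^{c₃/20} · 2^{-(c₂/1600) n^{2a}}`
  have hsave : (2 : ℝ) ^ (-(c₂ * distInt α ^ 2 * (2 * (⌊Real.log x / (80 * Real.log 2)⌋₊ : ℝ)) - c₃) / 20) ≤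
      (2 : ℝ) ^ (c₃ / 20) * (2 : ℝ) ^ (-(c₂ / 1600 * (n : ℝ) ^ (2 * a))) := by
    rw [← Real.rpow_add two_pos]
    refine Real.rpow_le_rpow_of_exponent_le one_le_two ?_
    linarith
  have hlogx : Real.log x ^ 4 ≤ ((n : ℝ) * Real.log 2) ^ 4 := by
    have h1 : Real.log x ≤ n * Real.log 2 := by
      have := Real.log_le_log hxpos hx_le
      rwa [Real.log_pow] at this
    exact pow_le_pow_left₀ (Real.log_nonneg (by exact_mod_cast (show 1 ≤ x by omega))) h1 4
  have hKle : K ≤ max K 0 := le_max_left _ _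
  have hB : max K 0 * Real.log 2 ^ 4 * (2 : ℝ) ^ (c₃ / 20) * (n : ℝ) ^ (4 + B) ≤
      (2 : ℝ) ^ (c₂ / 1600 * (n : ℝ) ^ (2 * a)) := hn
  -- assemble
  have hnB : (0 : ℝ) < (n : ℝ) ^ B := by positivity
  have hK0 : 0 ≤ max K 0 := le_max_right _ _
  have hS0 : (0 : ℝ) ≤ (2 : ℝ) ^ (-(c₂ * distInt α ^ 2 * (2 * (⌊Real.log x / (80 * Real.log 2)⌋₊ : ℝ)) - c₃) / 20) :=
    Real.rpow_nonneg zero_le_two _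
  have hL4 : (0 : ℝ) ≤ Real.log x ^ 4 := by positivity
  rw [le_div_iff₀ hnB]
  calc K * Real.log x ^ 4 * x *
        (2 : ℝ) ^ (-(c₂ * distInt α ^ 2 * (2 * (⌊Real.log x / (80 * Real.log 2)⌋₊ : ℝ)) - c₃) / 20) * (n : ℝ) ^ B
      ≤ max K 0 * Real.log x ^ 4 * x *
        (2 : ℝ) ^ (-(c₂ * distInt α ^ 2 * (2 * (⌊Real.log x / (80 * Real.log 2)⌋₊ : ℝ)) - c₃) / 20) * (n : ℝ) ^ B := by
          gcongr
    _ ≤ max K 0 * ((n : ℝ) * Real.log 2) ^ 4 * (2 : ℝ) ^ n *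
        ((2 : ℝ) ^ (c₃ / 20) * (2 : ℝ) ^ (-(c₂ / 1600 * (n : ℝ) ^ (2 * a)))) * (n : ℝ) ^ B := by
          gcongr
    _ = (max K 0 * Real.log 2 ^ 4 * (2 : ℝ) ^ (c₃ / 20) * (n : ℝ) ^ (4 + B)) *
        (2 : ℝ) ^ (-(c₂ / 1600 * (n : ℝ) ^ (2 * a))) * (2 : ℝ) ^ n := by ring
    _ ≤ (2 : ℝ) ^ (c₂ / 1600 * (n : ℝ) ^ (2 * a)) * (2 : ℝ) ^ (-(c₂ / 1600 * (n : ℝ) ^ (2 * a))) * (2 : ℝ) ^ n := by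
        gcongr
    _ = (2 : ℝ) ^ n := by
        rw [← Real.rpow_add two_pos, add_neg_cancel, Real.rpow_zero, one_mul]

end MoebiusSymm

/-- **Large frequencies of the Möbius–Gelfond sums, from Mauduit–Rivat 2015 Theorem 2** (named fact,
base 2): for every `a > 0` and `B`, eventually in `n`, `|Σ_{N<2ⁿ} μ(N) e(α s₂(N))| ≤ 2ⁿ/n^B` for all
`n^{a−1/2} ≤ |α| ≤ 1/2`. -/
theorem gelfondLarge_moebius_of_thm2 (h : Literature.NumberTheory.LFunctions.mauduitRivat2015_thm2_base2) :
    ∀ a : ℝ, 0 < a → ∀ B : ℕ, ∀ᶠ n : ℕ in atTop, ∀ α : ℝ,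
      (n : ℝ) ^ (a - 1 / 2) ≤ |α| → |α| ≤ 1 / 2 →
        ‖∑ N ∈ Finset.range (2 ^ n), ((ArithmeticFunction.moebius N : ℤ) : ℂ) *
            Complex.exp (((2 * Real.pi * α *
              ((Finset.univ.filter fun i : Fin n => Nat.testBit N i = true).card : ℝ) : ℝ) : ℂ) * Complex.I)‖
          ≤ (2 : ℝ) ^ n / (n : ℝ) ^ B :=
  MoebiusSymm.gelfondLarge_moebius_of_bound
    (Literature.NumberTheory.LFunctions.SumOfDigits.norm_sum_moebius_exp_digitSum_le_of_thm2 h)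

/-- **Kalai's `TC⁰` conjecture on the symmetric subclass, modulo Mauduit–Rivat 2015 Theorem 2.** If the
printed Theorem 2 (`mauduitRivat2015_thm2_base2`) holds, then for every `ε > 0`, eventually in `n`,
`|Σ_{N<2ⁿ} μ(N)·sgn G(s₂(N))| ≤ ε·2ⁿ` for EVERY Boolean function `G` of the Hamming weight of the binary
digits (small frequencies unconditionally by Bourgain's theorem for `μ`; the slice criterion). -/
theorem moebius_orthogonal_symmetric_of_thm2
    (h : Literature.NumberTheory.LFunctions.mauduitRivat2015_thm2_base2) :
    ∀ ε : ℝ, 0 < ε → ∀ᶠ n : ℕ in atTop, ∀ G : ℕ → Bool,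
      |∑ N ∈ Finset.range (2 ^ n), ((ArithmeticFunction.moebius N : ℤ) : ℝ) *
          sgn (G (Finset.univ.filter fun i : Fin n => Nat.testBit N i = true).card)| ≤ ε * (2 : ℝ) ^ n :=
  stub_symmetricRung_moebius stub_gelfondSmall_moebius (gelfondLarge_moebius_of_thm2 h)

/-- **Circuit form.** Modulo the printed Theorem 2, every circuit on `n` inputs (any gate basis, depth,
size) computing a SYMMETRIC function of its inputs is asymptotically orthogonal to `μ` on the binary
digits — Kalai's `TC⁰` conjecture restricted to symmetric circuits. -/
theorem moebius_orthogonal_symmetricCircuit_of_thm2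
    (h : Literature.NumberTheory.LFunctions.mauduitRivat2015_thm2_base2) :
    ∀ ε : ℝ, 0 < ε → ∀ᶠ n : ℕ in atTop, ∀ C : Circuit (Fin n),
      (∃ G : ℕ → Bool, ∀ x : Fin n → Bool,
          C.eval x = G (Finset.univ.filter fun i : Fin n => x i = true).card) →
        |∑ N ∈ Finset.range (2 ^ n), ((ArithmeticFunction.moebius N : ℤ) : ℝ) *
            sgn (C.eval (fun i : Fin n => Nat.testBit N i))| ≤ ε * (2 : ℝ) ^ n := by
  intro ε hε
  filter_upwards [moebius_orthogonal_symmetric_of_thm2 h ε hε] with n hn C hC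
  obtain ⟨G, hG⟩ := hC
  simp only [hG]
  exact hn G

end Summit.QuantumAdvantage.QuantumAdvantage.Theorems.LiouvilleOrthogonalTC0
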